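import Summits.CriticalPhenomena.PercolationContinuityZ3.Theorems.PercNearOneGluingNoHeavyLowerTailSahiGridPatternKappaForm

/-!
# `NoHeavyLowerTail` (crux stmt-CriticalPhenomena-4575), Sahi programme: **THE COSTLESS-SLOTS FACE OF COMB-M⁺, EVERY DIMENSION —
# at most one costly slot ⟹ `c₂ ≥ 2c₃ + c(A,B′,C′)`; with the free slot idle ⟹ `c₂ ≥ 3c₃` (sharp)**

Support file (seat `prim-ineq-gen-4`, generation 14; `--supports stmt-CriticalPhenomena-4575`).  Pure proofs, no definitions, no `sorry`, standard axioms.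
Vocabulary and machinery of `…SahiGridPattern{KappaForm,UpperStepForm,TwoLayerTop,TwoSetsTop,TopOnlyTop,Kleitman,Harris}`.

THE MATHEMATICS.  Upper-step triple `Au, Bu, Cu ⊆ [3]^{n+1}` (level-`1` slice = level-`2` slice), slices `A⁰ ⊆ A²`, `B⁰ ⊆ B²`, `C⁰ ⊆ C²` (up-sets of
`[3]^n`), increments `b = B² ∖ B⁰`, `c = C² ∖ C⁰`, `τ = (A²,B²,C²)` the top triple.  Call the slot of `B` COSTLESS if `b ∩ A² ∩ C² = ∅`, i.e.
`A²∩B²∩C² ⊆ B⁰` (no point leaves `B` while it lies in both other TOP slices), and likewise for `C` — the terminology of seat `prim-bnk-2`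
(generation 10, `…SahiTwoLevelCostlessSlots`), where the MEASURE-LEVEL identity
`T⁺ = E₃(G) + E₃(H₀,G₁,G₂) + δ₁Cov(G₀,G₂) + δ₂Cov(G₀,G₁) + g₂μ(D₁H₀) + g₁μ(D₂H₀) + g₀μ(G₁G₂∖H₁H₂)` is proved.  THIS FILE is its COEFFICIENTWISE
(every profile / Latin `sStarD`) version, every `n`:
* `sStarD_upperStep_costless₂₃_eq` (identity): if the slots of `B` and `C` are costless then
    `sStarD Au Bu Cu − 4·sStarD τ − 2·sStarD(A⁰,B²,C²) = 2·(Θ_B + Θ_C + g_A + g_B + g_C)`,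
  `Θ_B = [N(B²;A²,C²) − N(B⁰;A²,C²)] − [L(A²;B²,C²) − L(A²;B⁰,C²)]` (fibre-Kleitman gap with the increment `b` as free argument; `Θ_C` alike),
  `g_A = N(A²;B²,C²) − N(A²;B⁰,C⁰)`, `g_B = N(B²;A⁰,C²) − N(B²;A⁰,C⁰)`, `g_C = N(C²;A⁰,B²) − N(C²;A⁰,B⁰)` (monotone pair counts) — from the κ-form
  (`sStarD_upperStep_kappaForm`) and the counting forms of the two functionals: on this face `A²B²C² = A²B⁰C⁰` and `A⁰B²C⁰ = A⁰B⁰C² = A⁰B⁰C⁰ = A⁰B²C²`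
  pointwise, so the three Harris gaps of the κ-form telescope against `sStarD τ + sStarD(A⁰,B²,C²)` and `R₂ = 0`.
* `four_mul_sStarD_top_add_two_mul_le_of_upperStep_costless₂₃`: hence **`4·sStarD τ + 2·sStarD(A⁰,B²,C²) ≤ sStarD Au Bu Cu`** for up-sets
  (cube dictionary: `c₂ ≥ 2c₃ + c(A,B′,C′)` whenever at most the slot of `A` is costly), and `two_mul_sStarD_top_le_of_upperStep_costless₂₃`:
  COMB-M⁺ `2·sStarD τ ≤ sStarD υ` on this face as soon as the `n`-dimensional functionals `sStarD τ`, `sStarD(A⁰,B²,C²)` are nonnegative (`PatternPos n`).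
* `six_mul_sStarD_top_le_of_upperStep_cylinder_costless₂₃`: if moreover `A` is a cylinder (`A⁰ = A²`, the idle slot) then **`6·sStarD τ ≤ sStarD υ`**,
  i.e. `c₂ ≥ 3c₃` — containing seat `prim-bnk-2`'s THEOREM A ("removed parts outside `F`": `B²∩A² ⊆ B⁰`, `C²∩A² ⊆ C⁰`), SHARP (cube line `(2,6,6,2)`).
With the empty-bottom face (`…EmptyBottom`), the single-mover face and the `K(τ) ≥ 0` face (`…KappaForm`) this leaves COMB-M⁺ open exactly on the
core with at least TWO costly slots.  Memo: `run/shared/lean/prim/prim-ineq-gen-4/FINDING-COSTLESS-AND-CORE-g14.md`.  HONEST LABEL: COMB-M⁺ in general,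
`PatternPos d` (`d ≥ 4`), Sahi's `C₃` and Kahn's conjecture remain OPEN; nothing here asserts them. [this work]
-/

namespace Summit.CriticalPhenomena.PercolationContinuityZ3.Theorems.SahiGridPattern

open Finset SahiGrid3
open scoped BigOperators

variable {n : ℕ}

/-- Triple products of indicators agree at a point where the two membership triples are equivalent. [this work] -/
theorem ind3_eq_of_iff {Y : Type*} [DecidableEq Y] {X₁ X₂ X₃ Y₁ Y₂ Y₃ : Finset Y} {y : Y}
    (h : (y ∈ X₁ ∧ y ∈ X₂ ∧ y ∈ X₃) ↔ (y ∈ Y₁ ∧ y ∈ Y₂ ∧ y ∈ Y₃)) :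
    ind X₁ y * ind X₂ y * ind X₃ y = ind Y₁ y * ind Y₂ y * ind Y₃ y := by
  unfold ind
  by_cases h1 : y ∈ X₁ <;> by_cases h2 : y ∈ X₂ <;> by_cases h3 : y ∈ X₃ <;> by_cases k1 : y ∈ Y₁ <;> by_cases k2 : y ∈ Y₂ <;>
    by_cases k3 : y ∈ Y₃ <;> simp_all

/-- Monotonicity of a product `a·b·c·t` of nonnegative integers in its two middle factors. [this work] -/
theorem mul4_mono_mid {a b c b' c' t : ℤ} (ha : 0 ≤ a) (hb : 0 ≤ b) (hc : 0 ≤ c) (ht : 0 ≤ t) (hbb : b ≤ b') (hcc : c ≤ c') :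
    a * b * c * t ≤ a * b' * c' * t := by
  have h1 : b * c ≤ b' * c' := mul_le_mul hbb hcc hc (le_trans hb hbb)
  have h2 : a * (b * c) * t ≤ a * (b' * c') * t := mul_le_mul_of_nonneg_right (mul_le_mul_of_nonneg_left h1 ha) ht
  calc a * b * c * t = a * (b * c) * t := by ring
    _ ≤ a * (b' * c') * t := h2
    _ = a * b' * c' * t := by ring

/-- **THE COSTLESS-SLOTS IDENTITY** (every `n`): for an upper-step triple `Au, Bu, Cu ⊆ [3]^{n+1}` of up-sets whose `B`- and `C`-slots are costless
(`A²B²C² ⊆ B⁰` and `A²B²C² ⊆ C⁰`),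
`sStarD Au Bu Cu − 4·sStarD τ − 2·sStarD(A⁰,B²,C²) = 2·(Θ_B + Θ_C + g_A + g_B + g_C)` (all five terms written out in slice counts). [this work] -/
theorem sStarD_upperStep_costless₂₃_eq (Au Bu Cu : Finset (Pd (n + 1)))
    (hA : IsUpperSet (Au : Set (Pd (n + 1)))) (hB : IsUpperSet (Bu : Set (Pd (n + 1)))) (hC : IsUpperSet (Cu : Set (Pd (n + 1))))
    (hAu : ∀ q : Pd n, ind Au (Fin.snoc q 1 : Pd (n + 1)) = ind Au (Fin.snoc q 2 : Pd (n + 1)))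
    (hBu : ∀ q : Pd n, ind Bu (Fin.snoc q 1 : Pd (n + 1)) = ind Bu (Fin.snoc q 2 : Pd (n + 1)))
    (hCu : ∀ q : Pd n, ind Cu (Fin.snoc q 1 : Pd (n + 1)) = ind Cu (Fin.snoc q 2 : Pd (n + 1)))
    (hBcl : ∀ q : Pd n, (Fin.snoc q 2 : Pd (n + 1)) ∈ Au → (Fin.snoc q 2 : Pd (n + 1)) ∈ Bu → (Fin.snoc q 2 : Pd (n + 1)) ∈ Cu → (Fin.snoc q 0 : Pd (n + 1)) ∈ Bu)
    (hCcl : ∀ q : Pd n, (Fin.snoc q 2 : Pd (n + 1)) ∈ Au → (Fin.snoc q 2 : Pd (n + 1)) ∈ Bu → (Fin.snoc q 2 : Pd (n + 1)) ∈ Cu → (Fin.snoc q 0 : Pd (n + 1)) ∈ Cu) :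
    sStarD Au Bu Cu - 4 * sStarD (univ.filter fun q : Pd n => (Fin.snoc q 2 : Pd (n + 1)) ∈ Au) (univ.filter fun q : Pd n => (Fin.snoc q 2 : Pd (n + 1)) ∈ Bu) (univ.filter fun q : Pd n => (Fin.snoc q 2 : Pd (n + 1)) ∈ Cu) - 2 * sStarD (univ.filter fun q : Pd n => (Fin.snoc q 0 : Pd (n + 1)) ∈ Au) (univ.filter fun q : Pd n => (Fin.snoc q 2 : Pd (n + 1)) ∈ Bu) (univ.filter fun q : Pd n => (Fin.snoc q 2 : Pd (n + 1)) ∈ Cu) =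
      2 * (((∑ p, ∑ q, ind (univ.filter fun q : Pd n => (Fin.snoc q 2 : Pd (n + 1)) ∈ Bu) p * ind (univ.filter fun q : Pd n => (Fin.snoc q 2 : Pd (n + 1)) ∈ Au) q * ind (univ.filter fun q : Pd n => (Fin.snoc q 2 : Pd (n + 1)) ∈ Cu) q * (if TotDist p q = true then (1:ℤ) else 0)) - (∑ p, ∑ q, ind (univ.filter fun q : Pd n => (Fin.snoc q 0 : Pd (n + 1)) ∈ Bu) p * ind (univ.filter fun q : Pd n => (Fin.snoc q 2 : Pd (n + 1)) ∈ Au) q * ind (univ.filter fun q : Pd n => (Fin.snoc q 2 : Pd (n + 1)) ∈ Cu) q * (if TotDist p q = true then (1:ℤ) else 0)) - (∑ q, ∑ r, ind (univ.filter fun q : Pd n => (Fin.snoc q 2 : Pd (n + 1)) ∈ Bu) q * ind (univ.filter fun q : Pd n => (Fin.snoc q 2 : Pd (n + 1)) ∈ Cu) r * ind (univ.filter fun q : Pd n => (Fin.snoc q 2 : Pd (n + 1)) ∈ Au) (thirdPt q r) * (if TotDist q r = true then (1:ℤ) else 0)) + (∑ q, ∑ r, ind (univ.filter fun q : Pd n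 => (Fin.snoc q 0 : Pd (n + 1)) ∈ Bu) q * ind (univ.filter fun q : Pd n => (Fin.snoc q 2 : Pd (n + 1)) ∈ Cu) r * ind (univ.filter fun q : Pd n => (Fin.snoc q 2 : Pd (n + 1)) ∈ Au) (thirdPt q r) * (if TotDist q r = true then (1:ℤ) else 0)))
        + ((∑ p, ∑ q, ind (univ.filter fun q : Pd n => (Fin.snoc q 2 : Pd (n + 1)) ∈ Cu) p * ind (univ.filter fun q : Pd n => (Fin.snoc q 2 : Pd (n + 1)) ∈ Au) q * ind (univ.filter fun q : Pd n => (Fin.snoc q 2 : Pd (n + 1)) ∈ Bu) q * (if TotDist p q = true then (1:ℤ) else 0)) - (∑ p, ∑ q, ind (univ.filter fun q : Pd n => (Fin.snoc q 0 : Pd (n + 1)) ∈ Cu) p * ind (univ.filter fun q : Pd n => (Fin.snoc q 2 : Pd (n + 1)) ∈ Au) q * ind (univ.filter fun q : Pd n => (Fin.snoc q 2 : Pd (n + 1)) ∈ Bu) q * (if TotDist p q = true then (1:ℤ) else 0)) - (∑ q, ∑ r, ind (univ.filter fun q : Pd n => (Fin.snoc q 2 : Pd (n + 1)) ∈ Bu)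 q * ind (univ.filter fun q : Pd n => (Fin.snoc q 2 : Pd (n + 1)) ∈ Cu) r * ind (univ.filter fun q : Pd n => (Fin.snoc q 2 : Pd (n + 1)) ∈ Au) (thirdPt q r) * (if TotDist q r = true then (1:ℤ) else 0)) + (∑ q, ∑ r, ind (univ.filter fun q : Pd n => (Fin.snoc q 2 : Pd (n + 1)) ∈ Bu) q * ind (univ.filter fun q : Pd n => (Fin.snoc q 0 : Pd (n + 1)) ∈ Cu) r * ind (univ.filter fun q : Pd n => (Fin.snoc q 2 : Pd (n + 1)) ∈ Au) (thirdPt q r) * (if TotDist q r = true then (1:ℤ) else 0)))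
        + ((∑ p, ∑ q, ind (univ.filter fun q : Pd n => (Fin.snoc q 2 : Pd (n + 1)) ∈ Au) p * ind (univ.filter fun q : Pd n => (Fin.snoc q 2 : Pd (n + 1)) ∈ Bu) q * ind (univ.filter fun q : Pd n => (Fin.snoc q 2 : Pd (n + 1)) ∈ Cu) q * (if TotDist p q = true then (1:ℤ) else 0)) - (∑ p, ∑ q, ind (univ.filter fun q : Pd n => (Fin.snoc q 2 : Pd (n + 1)) ∈ Au) p * ind (univ.filter fun q : Pd n => (Fin.snoc q 0 : Pd (n + 1)) ∈ Bu) q * ind (univ.filter fun q : Pd n => (Fin.snoc q 0 : Pd (n + 1)) ∈ Cu) q * (if TotDist p q = true then (1:ℤ) else 0)))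
        + ((∑ p, ∑ q, ind (univ.filter fun q : Pd n => (Fin.snoc q 2 : Pd (n + 1)) ∈ Bu) p * ind (univ.filter fun q : Pd n => (Fin.snoc q 0 : Pd (n + 1)) ∈ Au) q * ind (univ.filter fun q : Pd n => (Fin.snoc q 2 : Pd (n + 1)) ∈ Cu) q * (if TotDist p q = true then (1:ℤ) else 0)) - (∑ p, ∑ q, ind (univ.filter fun q : Pd n => (Fin.snoc q 2 : Pd (n + 1)) ∈ Bu) p * ind (univ.filter fun q : Pd n => (Fin.snoc q 0 : Pd (n + 1)) ∈ Au) q * ind (univ.filter fun q : Pd n => (Fin.snoc q 0 : Pd (n + 1)) ∈ Cu) q * (if TotDist p q = true then (1:ℤ) else 0)))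
        + ((∑ p, ∑ q, ind (univ.filter fun q : Pd n => (Fin.snoc q 2 : Pd (n + 1)) ∈ Cu) p * ind (univ.filter fun q : Pd n => (Fin.snoc q 0 : Pd (n + 1)) ∈ Au) q * ind (univ.filter fun q : Pd n => (Fin.snoc q 2 : Pd (n + 1)) ∈ Bu) q * (if TotDist p q = true then (1:ℤ) else 0)) - (∑ p, ∑ q, ind (univ.filter fun q : Pd n => (Fin.snoc q 2 : Pd (n + 1)) ∈ Cu) p * ind (univ.filter fun q : Pd n => (Fin.snoc q 0 : Pd (n + 1)) ∈ Au) q * ind (univ.filter fun q : Pd n => (Fin.snoc q 0 : Pd (n + 1)) ∈ Bu) q * (if TotDist p q = true then (1:ℤ) else 0)))) := by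
  have eK := sStarD_upperStep_kappaForm Au Bu Cu hAu hBu hCu
  have eT := sStarD_counting (univ.filter fun q : Pd n => (Fin.snoc q 2 : Pd (n + 1)) ∈ Au) (univ.filter fun q : Pd n => (Fin.snoc q 2 : Pd (n + 1)) ∈ Bu) (univ.filter fun q : Pd n => (Fin.snoc q 2 : Pd (n + 1)) ∈ Cu)
  have eL := sStarD_counting (univ.filter fun q : Pd n => (Fin.snoc q 0 : Pd (n + 1)) ∈ Au) (univ.filter fun q : Pd n => (Fin.snoc q 2 : Pd (n + 1)) ∈ Bu) (univ.filter fun q : Pd n => (Fin.snoc q 2 : Pd (n + 1)) ∈ Cu)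
  have sA : ∀ q : Pd n, (Fin.snoc q 0 : Pd (n + 1)) ∈ Au → (Fin.snoc q 2 : Pd (n + 1)) ∈ Au :=
    fun q h => hA (snoc_le_snoc_of_le q (by decide : (0:Fin 3) ≤ 2)) h
  have sB : ∀ q : Pd n, (Fin.snoc q 0 : Pd (n + 1)) ∈ Bu → (Fin.snoc q 2 : Pd (n + 1)) ∈ Bu :=
    fun q h => hB (snoc_le_snoc_of_le q (by decide : (0:Fin 3) ≤ 2)) h
  have sC : ∀ q : Pd n, (Fin.snoc q 0 : Pd (n + 1)) ∈ Cu → (Fin.snoc q 2 : Pd (n + 1)) ∈ Cu :=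
    fun q h => hC (snoc_le_snoc_of_le q (by decide : (0:Fin 3) ≤ 2)) h
  -- the pointwise face equalities of triple products
  have pA : ∀ q : Pd n, ind (univ.filter fun q : Pd n => (Fin.snoc q 2 : Pd (n + 1)) ∈ Au) q * ind (univ.filter fun q : Pd n => (Fin.snoc q 2 : Pd (n + 1)) ∈ Bu) q * ind (univ.filter fun q : Pd n => (Fin.snoc q 2 : Pd (n + 1)) ∈ Cu) q = ind (univ.filter fun q : Pd n => (Fin.snoc q 2 : Pd (n + 1)) ∈ Au) q * ind (univ.filter fun q : Pd n => (Fin.snoc q 0 : Pd (n + 1)) ∈ Bu) q * ind (univ.filter fun q : Pd n => (Fin.snoc q 0 : Pd (n + 1)) ∈ Cu) q := by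
    intro q; apply ind3_eq_of_iff; simp only [mem_filter, mem_univ, true_and]
    exact ⟨fun h => ⟨h.1, hBcl q h.1 h.2.1 h.2.2, hCcl q h.1 h.2.1 h.2.2⟩, fun h => ⟨h.1, sB q h.2.1, sC q h.2.2⟩⟩
  have pB : ∀ q : Pd n, ind (univ.filter fun q : Pd n => (Fin.snoc q 0 : Pd (n + 1)) ∈ Au) q * ind (univ.filter fun q : Pd n => (Fin.snoc q 2 : Pd (n + 1)) ∈ Bu) q * ind (univ.filter fun q : Pd n => (Fin.snoc q 0 : Pd (n + 1)) ∈ Cu) q = ind (univ.filter fun q : Pd n => (Fin.snoc q 0 : Pd (n + 1)) ∈ Au) q * ind (univ.filter fun q : Pd n => (Fin.snoc q 2 : Pd (n + 1)) ∈ Bu) q * ind (univ.filter fun q : Pd n => (Fin.snoc q 2 : Pd (n + 1)) ∈ Cu) q := by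
    intro q; apply ind3_eq_of_iff; simp only [mem_filter, mem_univ, true_and]
    exact ⟨fun h => ⟨h.1, h.2.1, sC q h.2.2⟩, fun h => ⟨h.1, h.2.1, hCcl q (sA q h.1) h.2.1 h.2.2⟩⟩
  have pC : ∀ q : Pd n, ind (univ.filter fun q : Pd n => (Fin.snoc q 0 : Pd (n + 1)) ∈ Au) q * ind (univ.filter fun q : Pd n => (Fin.snoc q 0 : Pd (n + 1)) ∈ Bu) q * ind (univ.filter fun q : Pd n => (Fin.snoc q 2 : Pd (n + 1)) ∈ Cu) q = ind (univ.filter fun q : Pd n => (Fin.snoc q 0 : Pd (n + 1)) ∈ Au) q * ind (univ.filter fun q : Pd n => (Fin.snoc q 2 : Pd (n + 1)) ∈ Bu) q * ind (univ.filter fun q : Pd n => (Fin.snoc q 2 : Pd (n + 1)) ∈ Cu) q := by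
    intro q; apply ind3_eq_of_iff; simp only [mem_filter, mem_univ, true_and]
    exact ⟨fun h => ⟨h.1, sB q h.2.1, h.2.2⟩, fun h => ⟨h.1, hBcl q (sA q h.1) h.2.1 h.2.2, h.2.2⟩⟩
  have pR : ∀ q : Pd n, ind (univ.filter fun q : Pd n => (Fin.snoc q 0 : Pd (n + 1)) ∈ Au) q * ind (univ.filter fun q : Pd n => (Fin.snoc q 0 : Pd (n + 1)) ∈ Bu) q * ind (univ.filter fun q : Pd n => (Fin.snoc q 0 : Pd (n + 1)) ∈ Cu) q = ind (univ.filter fun q : Pd n => (Fin.snoc q 0 : Pd (n + 1)) ∈ Au) q * ind (univ.filter fun q : Pd n => (Fin.snoc q 2 : Pd (n + 1)) ∈ Bu) q * ind (univ.filter fun q : Pd n => (Fin.snoc q 2 : Pd (n + 1)) ∈ Cu) q := by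
    intro q; apply ind3_eq_of_iff; simp only [mem_filter, mem_univ, true_and]
    exact ⟨fun h => ⟨h.1, sB q h.2.1, sC q h.2.2⟩, fun h => ⟨h.1, hBcl q (sA q h.1) h.2.1 h.2.2, hCcl q (sA q h.1) h.2.1 h.2.2⟩⟩
  have dA : (∑ p, ind (univ.filter fun q : Pd n => (Fin.snoc q 2 : Pd (n + 1)) ∈ Au) p * ind (univ.filter fun q : Pd n => (Fin.snoc q 2 : Pd (n + 1)) ∈ Bu) p * ind (univ.filter fun q : Pd n => (Fin.snoc q 2 : Pd (n + 1)) ∈ Cu) p) = (∑ p, ind (univ.filter fun q : Pd n => (Fin.snoc q 2 : Pd (n + 1)) ∈ Au) p * ind (univ.filter fun q : Pd n => (Fin.snoc q 0 : Pd (n + 1)) ∈ Bu) p * ind (univ.filter fun q : Pd n => (Fin.snoc q 0 : Pd (n + 1)) ∈ Cu) p) := Finset.sum_congr rfl fun q _ => pA q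
  have dB : (∑ p, ind (univ.filter fun q : Pd n => (Fin.snoc q 0 : Pd (n + 1)) ∈ Au) p * ind (univ.filter fun q : Pd n => (Fin.snoc q 2 : Pd (n + 1)) ∈ Bu) p * ind (univ.filter fun q : Pd n => (Fin.snoc q 0 : Pd (n + 1)) ∈ Cu) p) = (∑ p, ind (univ.filter fun q : Pd n => (Fin.snoc q 0 : Pd (n + 1)) ∈ Au) p * ind (univ.filter fun q : Pd n => (Fin.snoc q 2 : Pd (n + 1)) ∈ Bu) p * ind (univ.filter fun q : Pd n => (Fin.snoc q 2 : Pd (n + 1)) ∈ Cu) p) := Finset.sum_congr rfl fun q _ => pB q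
  have dC : (∑ p, ind (univ.filter fun q : Pd n => (Fin.snoc q 0 : Pd (n + 1)) ∈ Au) p * ind (univ.filter fun q : Pd n => (Fin.snoc q 0 : Pd (n + 1)) ∈ Bu) p * ind (univ.filter fun q : Pd n => (Fin.snoc q 2 : Pd (n + 1)) ∈ Cu) p) = (∑ p, ind (univ.filter fun q : Pd n => (Fin.snoc q 0 : Pd (n + 1)) ∈ Au) p * ind (univ.filter fun q : Pd n => (Fin.snoc q 2 : Pd (n + 1)) ∈ Bu) p * ind (univ.filter fun q : Pd n => (Fin.snoc q 2 : Pd (n + 1)) ∈ Cu) p) := Finset.sum_congr rfl fun q _ => pC q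
  have dR : (∑ p, ind (univ.filter fun q : Pd n => (Fin.snoc q 0 : Pd (n + 1)) ∈ Au) p * ind (univ.filter fun q : Pd n => (Fin.snoc q 0 : Pd (n + 1)) ∈ Bu) p * ind (univ.filter fun q : Pd n => (Fin.snoc q 0 : Pd (n + 1)) ∈ Cu) p) = (∑ p, ind (univ.filter fun q : Pd n => (Fin.snoc q 0 : Pd (n + 1)) ∈ Au) p * ind (univ.filter fun q : Pd n => (Fin.snoc q 2 : Pd (n + 1)) ∈ Bu) p * ind (univ.filter fun q : Pd n => (Fin.snoc q 2 : Pd (n + 1)) ∈ Cu) p) := Finset.sum_congr rfl fun q _ => pR q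
  rw [dA, dB, dC, dR] at eK
  rw [dA] at eT
  linarith [eK, eT, eL]

/-- **`c₂ ≥ 2c₃ + c(A,B′,C′)` ON THE COSTLESS-SLOTS FACE** (every `n`): for an upper-step triple of up-sets `Au, Bu, Cu ⊆ [3]^{n+1}` whose `B`- and
`C`-slots are costless, `4·sStarD(A²,B²,C²) + 2·sStarD(A⁰,B²,C²) ≤ sStarD Au Bu Cu`.  Proof: the costless-slots identity; `Θ_B, Θ_C ≥ 0` by fibre
Kleitman with the increments as free argument; `g_A, g_B, g_C ≥ 0` by monotonicity of the slices. [this work] -/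
theorem four_mul_sStarD_top_add_two_mul_le_of_upperStep_costless₂₃ (Au Bu Cu : Finset (Pd (n + 1)))
    (hA : IsUpperSet (Au : Set (Pd (n + 1)))) (hB : IsUpperSet (Bu : Set (Pd (n + 1)))) (hC : IsUpperSet (Cu : Set (Pd (n + 1))))
    (hAu : ∀ q : Pd n, ind Au (Fin.snoc q 1 : Pd (n + 1)) = ind Au (Fin.snoc q 2 : Pd (n + 1)))
    (hBu : ∀ q : Pd n, ind Bu (Fin.snoc q 1 : Pd (n + 1)) = ind Bu (Fin.snoc q 2 : Pd (n + 1)))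
    (hCu : ∀ q : Pd n, ind Cu (Fin.snoc q 1 : Pd (n + 1)) = ind Cu (Fin.snoc q 2 : Pd (n + 1)))
    (hBcl : ∀ q : Pd n, (Fin.snoc q 2 : Pd (n + 1)) ∈ Au → (Fin.snoc q 2 : Pd (n + 1)) ∈ Bu → (Fin.snoc q 2 : Pd (n + 1)) ∈ Cu → (Fin.snoc q 0 : Pd (n + 1)) ∈ Bu)
    (hCcl : ∀ q : Pd n, (Fin.snoc q 2 : Pd (n + 1)) ∈ Au → (Fin.snoc q 2 : Pd (n + 1)) ∈ Bu → (Fin.snoc q 2 : Pd (n + 1)) ∈ Cu → (Fin.snoc q 0 : Pd (n + 1)) ∈ Cu) :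
    4 * sStarD (univ.filter fun q : Pd n => (Fin.snoc q 2 : Pd (n + 1)) ∈ Au) (univ.filter fun q : Pd n => (Fin.snoc q 2 : Pd (n + 1)) ∈ Bu) (univ.filter fun q : Pd n => (Fin.snoc q 2 : Pd (n + 1)) ∈ Cu) + 2 * sStarD (univ.filter fun q : Pd n => (Fin.snoc q 0 : Pd (n + 1)) ∈ Au) (univ.filter fun q : Pd n => (Fin.snoc q 2 : Pd (n + 1)) ∈ Bu) (univ.filter fun q : Pd n => (Fin.snoc q 2 : Pd (n + 1)) ∈ Cu) ≤ sStarD Au Bu Cu := by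
  have eI := sStarD_upperStep_costless₂₃_eq Au Bu Cu hA hB hC hAu hBu hCu hBcl hCcl
  have hA2up : IsUpperSet (((univ.filter fun q : Pd n => (Fin.snoc q 2 : Pd (n + 1)) ∈ Au) : Finset (Pd n)) : Set (Pd n)) := isUpperSet_filter_snoc hA 2
  have hB2up : IsUpperSet (((univ.filter fun q : Pd n => (Fin.snoc q 2 : Pd (n + 1)) ∈ Bu) : Finset (Pd n)) : Set (Pd n)) := isUpperSet_filter_snoc hB 2
  have hC2up : IsUpperSet (((univ.filter fun q : Pd n => (Fin.snoc q 2 : Pd (n + 1)) ∈ Cu) : Finset (Pd n)) : Set (Pd n)) := isUpperSet_filter_snoc hC 2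
  have sB : (univ.filter fun q : Pd n => (Fin.snoc q 0 : Pd (n + 1)) ∈ Bu) ⊆ (univ.filter fun q : Pd n => (Fin.snoc q 2 : Pd (n + 1)) ∈ Bu) := by
    intro q hq
    rw [mem_filter] at hq ⊢
    exact ⟨mem_univ _, hB (snoc_le_snoc_of_le q (by decide : (0:Fin 3) ≤ 2)) hq.2⟩
  have sC : (univ.filter fun q : Pd n => (Fin.snoc q 0 : Pd (n + 1)) ∈ Cu) ⊆ (univ.filter fun q : Pd n => (Fin.snoc q 2 : Pd (n + 1)) ∈ Cu) := by
    intro q hq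
    rw [mem_filter] at hq ⊢
    exact ⟨mem_univ _, hC (snoc_le_snoc_of_le q (by decide : (0:Fin 3) ≤ 2)) hq.2⟩
  have nB : ∀ p, ind (univ.filter fun q : Pd n => (Fin.snoc q 0 : Pd (n + 1)) ∈ Bu) p ≤ ind (univ.filter fun q : Pd n => (Fin.snoc q 2 : Pd (n + 1)) ∈ Bu) p := fun p => by
    rw [ind_filter_snoc, ind_filter_snoc]; exact ind_snoc_mono hB p (by decide)
  have nC : ∀ p, ind (univ.filter fun q : Pd n => (Fin.snoc q 0 : Pd (n + 1)) ∈ Cu) p ≤ ind (univ.filter fun q : Pd n => (Fin.snoc q 2 : Pd (n + 1)) ∈ Cu) p := fun p => by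
    rw [ind_filter_snoc, ind_filter_snoc]; exact ind_snoc_mono hC p (by decide)
  -- Θ_B ≥ 0 : fibre Kleitman with the increment B² \ B⁰ at the first point
  have TB : 0 ≤ ((∑ p, ∑ q, ind (univ.filter fun q : Pd n => (Fin.snoc q 2 : Pd (n + 1)) ∈ Bu) p * ind (univ.filter fun q : Pd n => (Fin.snoc q 2 : Pd (n + 1)) ∈ Au) q * ind (univ.filter fun q : Pd n => (Fin.snoc q 2 : Pd (n + 1)) ∈ Cu) q * (if TotDist p q = true then (1:ℤ) else 0)) - (∑ p, ∑ q, ind (univ.filter fun q : Pd n => (Fin.snoc q 0 : Pd (n + 1)) ∈ Bu) p * ind (univ.filter fun q : Pd n => (Fin.snoc q 2 : Pd (n + 1)) ∈ Au) q * ind (univ.filter fun q : Pd n => (Fin.snoc q 2 : Pd (n + 1)) ∈ Cu) q * (if TotDist p q = true then (1:ℤ) else 0)) - (∑ q, ∑ r, ind (univ.filter fun q : Pd n => (Fin.snoc q 2 : Pd (n + 1)) ∈ Bu) q * ind (univ.filter fun q : Pd n => (Fin.snoc q 2 : Pd (n + 1)) ∈ Cu) r * ind (univ.filter fun q : Pd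 n => (Fin.snoc q 2 : Pd (n + 1)) ∈ Au) (thirdPt q r) * (if TotDist q r = true then (1:ℤ) else 0)) + (∑ q, ∑ r, ind (univ.filter fun q : Pd n => (Fin.snoc q 0 : Pd (n + 1)) ∈ Bu) q * ind (univ.filter fun q : Pd n => (Fin.snoc q 2 : Pd (n + 1)) ∈ Cu) r * ind (univ.filter fun q : Pd n => (Fin.snoc q 2 : Pd (n + 1)) ∈ Au) (thirdPt q r) * (if TotDist q r = true then (1:ℤ) else 0))) := by
    have K0 := sum_ind_lat_le_td ((univ.filter fun q : Pd n => (Fin.snoc q 2 : Pd (n + 1)) ∈ Bu) \ (univ.filter fun q : Pd n => (Fin.snoc q 0 : Pd (n + 1)) ∈ Bu)) hC2up hA2up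
    have e1 : (∑ p, ∑ q, ind ((univ.filter fun q : Pd n => (Fin.snoc q 2 : Pd (n + 1)) ∈ Bu) \ (univ.filter fun q : Pd n => (Fin.snoc q 0 : Pd (n + 1)) ∈ Bu)) p * ind (univ.filter fun q : Pd n => (Fin.snoc q 2 : Pd (n + 1)) ∈ Cu) q * ind (univ.filter fun q : Pd n => (Fin.snoc q 2 : Pd (n + 1)) ∈ Au) (thirdPt p q) * (if TotDist p q = true then (1:ℤ) else 0)) =
        (∑ q, ∑ r, ind (univ.filter fun q : Pd n => (Fin.snoc q 2 : Pd (n + 1)) ∈ Bu) q * ind (univ.filter fun q : Pd n => (Fin.snoc q 2 : Pd (n + 1)) ∈ Cu) r * ind (univ.filter fun q : Pd n => (Fin.snoc q 2 : Pd (n + 1)) ∈ Au) (thirdPt q r) * (if TotDist q r = true then (1:ℤ) else 0)) - (∑ q, ∑ r, ind (univ.filter fun q : Pd n => (Fin.snoc q 0 : Pd (n + 1)) ∈ Bu) q * ind (univ.filter fun q : Pd n => (Fin.snoc q 2 : Pd (n + 1)) ∈ Cu) r * ind (univ.filter fun q : Pd n => (Fin.snoc q 2 : Pd (n + 1)) ∈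 Au) (thirdPt q r) * (if TotDist q r = true then (1:ℤ) else 0)) := by
      rw [← Finset.sum_sub_distrib]
      refine Finset.sum_congr rfl fun p _ => ?_
      rw [← Finset.sum_sub_distrib]
      refine Finset.sum_congr rfl fun q _ => ?_
      rw [ind_sdiff_of_subset sB]; ring
    have e2 : (∑ p, ∑ q, ind ((univ.filter fun q : Pd n => (Fin.snoc q 2 : Pd (n + 1)) ∈ Bu) \ (univ.filter fun q : Pd n => (Fin.snoc q 0 : Pd (n + 1)) ∈ Bu)) p * ind (univ.filter fun q : Pd n => (Fin.snoc q 2 : Pd (n + 1)) ∈ Cu) q * ind (univ.filter fun q : Pd n => (Fin.snoc q 2 : Pd (n + 1)) ∈ Au) q * (if TotDist p q = true then (1:ℤ) else 0)) =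
        (∑ p, ∑ q, ind (univ.filter fun q : Pd n => (Fin.snoc q 2 : Pd (n + 1)) ∈ Bu) p * ind (univ.filter fun q : Pd n => (Fin.snoc q 2 : Pd (n + 1)) ∈ Au) q * ind (univ.filter fun q : Pd n => (Fin.snoc q 2 : Pd (n + 1)) ∈ Cu) q * (if TotDist p q = true then (1:ℤ) else 0)) - (∑ p, ∑ q, ind (univ.filter fun q : Pd n => (Fin.snoc q 0 : Pd (n + 1)) ∈ Bu) p * ind (univ.filter fun q : Pd n => (Fin.snoc q 2 : Pd (n + 1)) ∈ Au) q * ind (univ.filter fun q : Pd n => (Fin.snoc q 2 : Pd (n + 1)) ∈ Cu) q * (if TotDist p q = true then (1:ℤ) else 0)) := by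
      rw [← Finset.sum_sub_distrib]
      refine Finset.sum_congr rfl fun p _ => ?_
      rw [← Finset.sum_sub_distrib]
      refine Finset.sum_congr rfl fun q _ => ?_
      rw [ind_sdiff_of_subset sB]; ring
    rw [e1, e2] at K0
    linarith
  -- Θ_C ≥ 0 : fibre Kleitman with the increment C² \ C⁰ at the first point, re-indexed
  have TC : 0 ≤ ((∑ p, ∑ q, ind (univ.filter fun q : Pd n => (Fin.snoc q 2 : Pd (n + 1)) ∈ Cu) p * ind (univ.filter fun q : Pd n => (Fin.snoc q 2 : Pd (n + 1)) ∈ Au) q * ind (univ.filter fun q : Pd n => (Fin.snoc q 2 : Pd (n + 1)) ∈ Bu) q * (if TotDist p q = true then (1:ℤ) else 0)) - (∑ p, ∑ q, ind (univ.filter fun q : Pd n => (Fin.snoc q 0 : Pd (n + 1)) ∈ Cu) p * ind (univ.filter fun q : Pd n => (Fin.snoc q 2 : Pd (n + 1)) ∈ Au) q * ind (univ.filter fun q : Pd n => (Fin.snoc q 2 : Pd (n + 1)) ∈ Bu) q * (if TotDist p q = true then (1:ℤ) else 0)) - (∑ q, ∑ r, ind (univ.filter fun q : Pd n => (Fin.snoc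 q 2 : Pd (n + 1)) ∈ Bu) q * ind (univ.filter fun q : Pd n => (Fin.snoc q 2 : Pd (n + 1)) ∈ Cu) r * ind (univ.filter fun q : Pd n => (Fin.snoc q 2 : Pd (n + 1)) ∈ Au) (thirdPt q r) * (if TotDist q r = true then (1:ℤ) else 0)) + (∑ q, ∑ r, ind (univ.filter fun q : Pd n => (Fin.snoc q 2 : Pd (n + 1)) ∈ Bu) q * ind (univ.filter fun q : Pd n => (Fin.snoc q 0 : Pd (n + 1)) ∈ Cu) r * ind (univ.filter fun q : Pd n => (Fin.snoc q 2 : Pd (n + 1)) ∈ Au) (thirdPt q r) * (if TotDist q r = true then (1:ℤ) else 0))) := by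
    have K0 := sum_ind_lat_le_td ((univ.filter fun q : Pd n => (Fin.snoc q 2 : Pd (n + 1)) ∈ Cu) \ (univ.filter fun q : Pd n => (Fin.snoc q 0 : Pd (n + 1)) ∈ Cu)) hB2up hA2up
    have e1 : (∑ p, ∑ q, ind ((univ.filter fun q : Pd n => (Fin.snoc q 2 : Pd (n + 1)) ∈ Cu) \ (univ.filter fun q : Pd n => (Fin.snoc q 0 : Pd (n + 1)) ∈ Cu)) p * ind (univ.filter fun q : Pd n => (Fin.snoc q 2 : Pd (n + 1)) ∈ Bu) q * ind (univ.filter fun q : Pd n => (Fin.snoc q 2 : Pd (n + 1)) ∈ Au) (thirdPt p q) * (if TotDist p q = true then (1:ℤ) else 0)) =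
        (∑ q, ∑ r, ind (univ.filter fun q : Pd n => (Fin.snoc q 2 : Pd (n + 1)) ∈ Bu) q * ind (univ.filter fun q : Pd n => (Fin.snoc q 2 : Pd (n + 1)) ∈ Cu) r * ind (univ.filter fun q : Pd n => (Fin.snoc q 2 : Pd (n + 1)) ∈ Au) (thirdPt q r) * (if TotDist q r = true then (1:ℤ) else 0)) - (∑ q, ∑ r, ind (univ.filter fun q : Pd n => (Fin.snoc q 2 : Pd (n + 1)) ∈ Bu) q * ind (univ.filter fun q : Pd n => (Fin.snoc q 0 : Pd (n + 1)) ∈ Cu) r * ind (univ.filter fun q : Pd n => (Fin.snoc q 2 : Pd (n + 1)) ∈ Au) (thirdPt q r) * (if TotDist q r = true then (1:ℤ) else 0)) := by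
      rw [Finset.sum_comm, ← Finset.sum_sub_distrib]
      refine Finset.sum_congr rfl fun q _ => ?_
      rw [← Finset.sum_sub_distrib]
      refine Finset.sum_congr rfl fun r _ => ?_
      rw [ind_sdiff_of_subset sC, thirdPt_comm r q, totDist_symm r q]; ring
    have e2 : (∑ p, ∑ q, ind ((univ.filter fun q : Pd n => (Fin.snoc q 2 : Pd (n + 1)) ∈ Cu) \ (univ.filter fun q : Pd n => (Fin.snoc q 0 : Pd (n + 1)) ∈ Cu)) p * ind (univ.filter fun q : Pd n => (Fin.snoc q 2 : Pd (n + 1)) ∈ Bu) q * ind (univ.filter fun q : Pd n => (Fin.snoc q 2 : Pd (n + 1)) ∈ Au) q * (if TotDist p q = true then (1:ℤ) else 0)) =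
        (∑ p, ∑ q, ind (univ.filter fun q : Pd n => (Fin.snoc q 2 : Pd (n + 1)) ∈ Cu) p * ind (univ.filter fun q : Pd n => (Fin.snoc q 2 : Pd (n + 1)) ∈ Au) q * ind (univ.filter fun q : Pd n => (Fin.snoc q 2 : Pd (n + 1)) ∈ Bu) q * (if TotDist p q = true then (1:ℤ) else 0)) - (∑ p, ∑ q, ind (univ.filter fun q : Pd n => (Fin.snoc q 0 : Pd (n + 1)) ∈ Cu) p * ind (univ.filter fun q : Pd n => (Fin.snoc q 2 : Pd (n + 1)) ∈ Au) q * ind (univ.filter fun q : Pd n => (Fin.snoc q 2 : Pd (n + 1)) ∈ Bu) q * (if TotDist p q = true then (1:ℤ) else 0)) := by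
      rw [← Finset.sum_sub_distrib]
      refine Finset.sum_congr rfl fun p _ => ?_
      rw [← Finset.sum_sub_distrib]
      refine Finset.sum_congr rfl fun q _ => ?_
      rw [ind_sdiff_of_subset sC]; ring
    rw [e1, e2] at K0
    linarith
  -- g_A, g_B, g_C ≥ 0 : monotone pair counts
  have GA : (∑ p, ∑ q, ind (univ.filter fun q : Pd n => (Fin.snoc q 2 : Pd (n + 1)) ∈ Au) p * ind (univ.filter fun q : Pd n => (Fin.snoc q 0 : Pd (n + 1)) ∈ Bu) q * ind (univ.filter fun q : Pd n => (Fin.snoc q 0 : Pd (n + 1)) ∈ Cu) q * (if TotDist p q = true then (1:ℤ) else 0)) ≤ (∑ p, ∑ q, ind (univ.filter fun q : Pd n => (Fin.snoc q 2 : Pd (n + 1)) ∈ Au) p * ind (univ.filter fun q : Pd n => (Fin.snoc q 2 : Pd (n + 1)) ∈ Bu) q * ind (univ.filter fun q : Pd n => (Fin.snoc q 2 : Pd (n + 1)) ∈ Cu) q * (if TotDist p q = true then (1:ℤ) else 0)) :=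
    Finset.sum_le_sum fun p _ => Finset.sum_le_sum fun q _ =>
      mul4_mono_mid (ind_nonneg' _ _) (ind_nonneg' _ _) (ind_nonneg' _ _) (by split_ifs <;> norm_num) (nB q) (nC q)
  have GB : (∑ p, ∑ q, ind (univ.filter fun q : Pd n => (Fin.snoc q 2 : Pd (n + 1)) ∈ Bu) p * ind (univ.filter fun q : Pd n => (Fin.snoc q 0 : Pd (n + 1)) ∈ Au) q * ind (univ.filter fun q : Pd n => (Fin.snoc q 0 : Pd (n + 1)) ∈ Cu) q * (if TotDist p q = true then (1:ℤ) else 0)) ≤ (∑ p, ∑ q, ind (univ.filter fun q : Pd n => (Fin.snoc q 2 : Pd (n + 1)) ∈ Bu) p * ind (univ.filter fun q : Pd n => (Fin.snoc q 0 : Pd (n + 1)) ∈ Au) q * ind (univ.filter fun q : Pd n => (Fin.snoc q 2 : Pd (n + 1)) ∈ Cu) q * (if TotDist p q = true then (1:ℤ) else 0)) :=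
    Finset.sum_le_sum fun p _ => Finset.sum_le_sum fun q _ =>
      mul4_mono_mid (ind_nonneg' _ _) (ind_nonneg' _ _) (ind_nonneg' _ _) (by split_ifs <;> norm_num) (le_refl _) (nC q)
  have GC : (∑ p, ∑ q, ind (univ.filter fun q : Pd n => (Fin.snoc q 2 : Pd (n + 1)) ∈ Cu) p * ind (univ.filter fun q : Pd n => (Fin.snoc q 0 : Pd (n + 1)) ∈ Au) q * ind (univ.filter fun q : Pd n => (Fin.snoc q 0 : Pd (n + 1)) ∈ Bu) q * (if TotDist p q = true then (1:ℤ) else 0)) ≤ (∑ p, ∑ q, ind (univ.filter fun q : Pd n => (Fin.snoc q 2 : Pd (n + 1)) ∈ Cu) p * ind (univ.filter fun q : Pd n => (Fin.snoc q 0 : Pd (n + 1)) ∈ Au) q * ind (univ.filter fun q : Pd n => (Fin.snoc q 2 : Pd (n + 1)) ∈ Bu) q * (if TotDist p q = true then (1:ℤ) else 0)) :=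
    Finset.sum_le_sum fun p _ => Finset.sum_le_sum fun q _ =>
      mul4_mono_mid (ind_nonneg' _ _) (ind_nonneg' _ _) (ind_nonneg' _ _) (by split_ifs <;> norm_num) (le_refl _) (nB q)
  linarith [eI, TB, TC, GA, GB, GC]

/-- **COMB-M⁺ ON THE COSTLESS-SLOTS FACE** (every `n`): for an upper-step triple of up-sets with costless `B`- and `C`-slots, top-slice dominance
`2·sStarD τ ≤ sStarD υ` holds as soon as the two `n`-dimensional pattern functionals `sStarD τ` and `sStarD(A⁰,B²,C²)` are nonnegative (instances of
`PatternPos n`; unconditional for `n ≤ 3`).  So the upper-step induction to Kahn's conjecture is open only at pairs with at least two costly slots. [this work] -/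
theorem two_mul_sStarD_top_le_of_upperStep_costless₂₃ (Au Bu Cu : Finset (Pd (n + 1)))
    (hA : IsUpperSet (Au : Set (Pd (n + 1)))) (hB : IsUpperSet (Bu : Set (Pd (n + 1)))) (hC : IsUpperSet (Cu : Set (Pd (n + 1))))
    (hAu : ∀ q : Pd n, ind Au (Fin.snoc q 1 : Pd (n + 1)) = ind Au (Fin.snoc q 2 : Pd (n + 1)))
    (hBu : ∀ q : Pd n, ind Bu (Fin.snoc q 1 : Pd (n + 1)) = ind Bu (Fin.snoc q 2 : Pd (n + 1)))
    (hCu : ∀ q : Pd n, ind Cu (Fin.snoc q 1 : Pd (n + 1)) = ind Cu (Fin.snoc q 2 : Pd (n + 1)))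
    (hBcl : ∀ q : Pd n, (Fin.snoc q 2 : Pd (n + 1)) ∈ Au → (Fin.snoc q 2 : Pd (n + 1)) ∈ Bu → (Fin.snoc q 2 : Pd (n + 1)) ∈ Cu → (Fin.snoc q 0 : Pd (n + 1)) ∈ Bu)
    (hCcl : ∀ q : Pd n, (Fin.snoc q 2 : Pd (n + 1)) ∈ Au → (Fin.snoc q 2 : Pd (n + 1)) ∈ Bu → (Fin.snoc q 2 : Pd (n + 1)) ∈ Cu → (Fin.snoc q 0 : Pd (n + 1)) ∈ Cu)
    (htop : 0 ≤ sStarD (univ.filter fun q : Pd n => (Fin.snoc q 2 : Pd (n + 1)) ∈ Au) (univ.filter fun q : Pd n => (Fin.snoc q 2 : Pd (n + 1)) ∈ Bu) (univ.filter fun q : Pd n => (Fin.snoc q 2 : Pd (n + 1)) ∈ Cu))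
    (hlow : 0 ≤ sStarD (univ.filter fun q : Pd n => (Fin.snoc q 0 : Pd (n + 1)) ∈ Au) (univ.filter fun q : Pd n => (Fin.snoc q 2 : Pd (n + 1)) ∈ Bu) (univ.filter fun q : Pd n => (Fin.snoc q 2 : Pd (n + 1)) ∈ Cu)) :
    2 * sStarD (univ.filter fun q : Pd n => (Fin.snoc q 2 : Pd (n + 1)) ∈ Au) (univ.filter fun q : Pd n => (Fin.snoc q 2 : Pd (n + 1)) ∈ Bu) (univ.filter fun q : Pd n => (Fin.snoc q 2 : Pd (n + 1)) ∈ Cu) ≤ sStarD Au Bu Cu := by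
  have h := four_mul_sStarD_top_add_two_mul_le_of_upperStep_costless₂₃ Au Bu Cu hA hB hC hAu hBu hCu hBcl hCcl
  linarith

/-- **`c₂ ≥ 3c₃` WHEN THE FREE SLOT IS IDLE** (every `n`; SHARP): for an upper-step triple of up-sets `Au, Bu, Cu ⊆ [3]^{n+1}` with `A` a cylinder
along the last axis (`A⁰ = A²`) and costless `B`- and `C`-slots (in particular when `B² ∩ A² ⊆ B⁰` and `C² ∩ A² ⊆ C⁰`: "all removed parts lie outside
the idle set", seat `prim-bnk-2`'s THEOREM A), `6·sStarD(A²,B²,C²) ≤ sStarD Au Bu Cu`. [this work] -/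
theorem six_mul_sStarD_top_le_of_upperStep_cylinder_costless₂₃ (Au Bu Cu : Finset (Pd (n + 1)))
    (hA : IsUpperSet (Au : Set (Pd (n + 1)))) (hB : IsUpperSet (Bu : Set (Pd (n + 1)))) (hC : IsUpperSet (Cu : Set (Pd (n + 1))))
    (hAu : ∀ q : Pd n, ind Au (Fin.snoc q 1 : Pd (n + 1)) = ind Au (Fin.snoc q 2 : Pd (n + 1)))
    (hBu : ∀ q : Pd n, ind Bu (Fin.snoc q 1 : Pd (n + 1)) = ind Bu (Fin.snoc q 2 : Pd (n + 1)))
    (hCu : ∀ q : Pd n, ind Cu (Fin.snoc q 1 : Pd (n + 1)) = ind Cu (Fin.snoc q 2 : Pd (n + 1)))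
    (hBcl : ∀ q : Pd n, (Fin.snoc q 2 : Pd (n + 1)) ∈ Au → (Fin.snoc q 2 : Pd (n + 1)) ∈ Bu → (Fin.snoc q 2 : Pd (n + 1)) ∈ Cu → (Fin.snoc q 0 : Pd (n + 1)) ∈ Bu)
    (hCcl : ∀ q : Pd n, (Fin.snoc q 2 : Pd (n + 1)) ∈ Au → (Fin.snoc q 2 : Pd (n + 1)) ∈ Bu → (Fin.snoc q 2 : Pd (n + 1)) ∈ Cu → (Fin.snoc q 0 : Pd (n + 1)) ∈ Cu)
    (hAcyl : ∀ q : Pd n, ind Au (Fin.snoc q 0 : Pd (n + 1)) = ind Au (Fin.snoc q 2 : Pd (n + 1))) :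
    6 * sStarD (univ.filter fun q : Pd n => (Fin.snoc q 2 : Pd (n + 1)) ∈ Au) (univ.filter fun q : Pd n => (Fin.snoc q 2 : Pd (n + 1)) ∈ Bu) (univ.filter fun q : Pd n => (Fin.snoc q 2 : Pd (n + 1)) ∈ Cu) ≤ sStarD Au Bu Cu := by
  have h := four_mul_sStarD_top_add_two_mul_le_of_upperStep_costless₂₃ Au Bu Cu hA hB hC hAu hBu hCu hBcl hCcl
  have e : (univ.filter fun q : Pd n => (Fin.snoc q 0 : Pd (n + 1)) ∈ Au) = (univ.filter fun q : Pd n => (Fin.snoc q 2 : Pd (n + 1)) ∈ Au) := by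
    ext q
    simp only [mem_filter, mem_univ, true_and]
    have hq := hAcyl q
    unfold ind at hq
    by_cases h0 : (Fin.snoc q 0 : Pd (n + 1)) ∈ Au <;> by_cases h2 : (Fin.snoc q 2 : Pd (n + 1)) ∈ Au <;> simp_all
  rw [e] at h
  linarith

end Summit.CriticalPhenomena.PercolationContinuityZ3.Theorems.SahiGridPattern
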